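import Summits.ABC.IUTFork.Cor312EdgeRegions
import HarnessLib

/-!
# [IUTchIII] Corollary 3.12 — readings of the edge, IV: Yamashita's "contains a region isomorphic to the
`q`-pilot region" (c312 crew, V-d)

Record-only file (D-0012) of the abc-iut cell; TAKES NO SIDE. `Cor312Chain.lean` isolates the content of
the printed proof of [IUTchIII] Cor. 3.12 beyond its 85 cited loci and 36 qualitative observations in ONE
named edge, `RealEdges.inclusion` (Step (xi-f), kurims p. 184 l. 19–29); `Cor312EdgeRegions.lean` (V-b)
reads that edge at the level of Cor. 3.12's own nouns (skel XVII `Cor312Setting`: possible images `U_λ` of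
the Θ-pilot object, their holomorphic hull `U^{hol}`, the `q`-pilot image `Q`, one log-volume `ln ν̄`) and
records THREE printed readings, each sufficient: R1 `RepresentedVol` (LANA §8.3, = (9-1)), R2 `QSubHull`,
R3 `QIsImage`.

This file adds the FOURTH printed rendering of the same sentence, the one in Yamashita's survey
(Yamashita2024IUTSurvey, Cor. 13.13 = [IUTchIII] Cor. 3.12; statement printed p. 359 l. 27 – p. 360 l. 8,
proof = ONE paragraph, p. 360 ll. 9–40 — read on the page, PDF pp. 389–390 of the 25 Jun 2024 version).
The sentence standing where Mochizuki's (xi-d)–(xi-f) stand is, verbatim (p. 360 ll. 30–40):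

> "Then Corollary follows by comparing the log-volumes (Note that log-volumes are invariant under
> (Indet ↷), (Indet →), and also compatible with log-Kummer correspondence of Theorem 13.12 (2)) of
> (1,0)-labelled q-pilot objects (by the compatibility with Θ^{×μ}_{LGP}-link of Theorem 13.12 (3)) and
> (1,◦)-labelled Θ-pilot objects, since, in the mono-analytic containers (i.e., ℚ-spans of log-shells),
> the holomorphic hull of the union of possible images of Θ-pilot objects subject to indeterminacies
> (Indet ↷), (Indet →), (Indet ↑) contains a region which is isomorphic (not equal) to the region
> determined by the q-pilot objects (This means that "very small region with indeterminacies" contains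
> "almost unit region")."

Read one level down, in the setting's nouns, this is a CONTAINMENT-UP-TO-ISOMORPHISM reading:

* R4 (transport level) `QIsoSubHull Φ`: for a family `Φ` of isomorphisms of the container under which
  admissibility and log-volume are invariant ("log-volumes are invariant under (Indet ↷), (Indet →)" —
  the first clause of the proof's own Step (x) observation `Obs.logvolInvariantInequality`, p. 181
  l. 5–13), SOME member carries `Q` into `U^{hol}`;
* R4 (volume level) `QCongruentSubHull`: `U^{hol}` contains an admissible region with the log-volume of
  `Q` — what the transport form leaves once the isomorphism is forgotten (`qCongruentSubHull_of_qIsoSubHull`).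

What the kernel then sees (all one-to-five-line consequences of LANDED skel theorems plus two finite
witnesses; nothing asserted):

* R4 SUFFICES: `cor312_of_qCongruentSubHull`, `cor312_of_qIsoSubHull` (monotonicity of `ln ν̄`), hence the
  real edges `realEdges_of_qCongruentSubHull_reading` / `realEdges_of_qIsoSubHull_reading`.
* R4 IS THE WEAKEST OF THE FOUR: R1 ⟹ R4 (`qCongruentSubHull_of_representedVol`: the representing image is
  the region), R2 ⟹ R4 (`…_of_qSubHull`: `Q` itself), R3 ⟹ R4; and for the one-member family `{id}` the
  transport form IS R2 (`qIsoSubHull_refl_iff`). Yamashita's parenthetical "(not equal)" is exactly the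
  clause separating R4 from R2/R3.
* CONVERSELY NOTHING, BOTH WAYS: `yamashita_not_imp_readings` — a finite setting and a log-volume-preserving
  involution under which R4 holds (transport AND volume level, indeed Cor. 3.12 holds) while R1, R2, R3 and
  LANA's (9-1) all fail; `edge_not_imp_yamashita` — a finite setting in which the real edges hold for every
  reading `O` (Cor. 3.12 holds: `−5/2 ≤ −1`) while NO admissible sub-region of `U^{hol}` has the `q`-pilot
  log-volume, so R4 fails at volume level and at transport level for EVERY invariant family. The edge is
  weaker than each of the four readings offered for it; which reading, if any, [IUTchIII] supplies is what
  the printed positions dispute — not recorded here as anyone's.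

Tags: `cite` records whose WORDS (Yamashita2024IUTSurvey), the claim tag whose CLAIM (Mochizuki2012, D-0012:
disputed) — no reading is privileged by its tag (skel R8-N1). Deliberately NOT here: which maps (Indet ↷)/(Indet →)
induce on an honest tensor-packet container (c312-1 K-file `ProcessionAut`, c312-d1 `HaarTransport`), any judgement.
-/

noncomputable section

namespace Summit.ABC.IUTFork

open Set

namespace Cor312Setting

variable (C : Cor312Setting)

/-! ## 1. Reading 4 at volume level and at transport level (hypotheses, none asserted) -/

/-- READING 4 (regions, containment up to isomorphism; VOLUME level) — Yamashita2024IUTSurvey Cor. 13.13,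
proof p. 360 ll. 35–40: "the holomorphic hull of the union of possible images of Θ-pilot objects subject
to indeterminacies (Indet ↷), (Indet →), (Indet ↑) contains a region which is isomorphic (not equal) to
the region determined by the q-pilot objects", with ll. 30–31 "(Note that log-volumes are invariant under
(Indet ↷), (Indet →) …)" — read with the isomorphism forgotten: `U^{hol}` contains an ADMISSIBLE region
whose log-volume is `−|log(q)|`. HYPOTHESIS. [cite: Yamashita2024IUTSurvey, Cor. 13.13 proof p. 360
ll. 30–40 (PDF p. 390)] [claim: Mochizuki2012, status: disputed] -/
@[cite "Yamashita2024IUTSurvey" "Cor. 13.13 proof p. 360 ll. 30–40"]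
def QCongruentSubHull : Prop := ∃ R : Set C.L, C.Adm R ∧ R ⊆ C.Uhol ∧ C.logvol R = C.negAbsLogq

/-- The isomorphisms Reading 4 quantifies over, as a HYPOTHESIS structure on a setting: a family of
self-bijections of the container's carrier ("isomorphic … in the mono-analytic containers (i.e., ℚ-spans
of log-shells)", p. 360 ll. 35–38) under which admissible regions go to admissible regions of the SAME
log-volume — Yamashita p. 360 ll. 30–31 "log-volumes are invariant under (Indet ↷), (Indet →)";
[IUTchIII] Step (x) p. 181 l. 5–13 "the resulting log-volumes `∈ ℝ` are invariant with respect to the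
indeterminacies (Ind1), (Ind2)" (`Cor312Proof.Obs.logvolInvariantInequality`, first clause). Objects and
the two invariances only; which maps the indeterminacies induce is not modelled here.
[cite: Yamashita2024IUTSurvey, Cor. 13.13 proof p. 360 ll. 30–31] [claim: Mochizuki2012, status: disputed] -/
structure IsoFamily where
  /-- indices of the isomorphisms -/
  I : Type
  /-- the isomorphisms, as self-bijections of the carrier of the container -/
  map : I → C.L ≃ C.L
  /-- images of admissible regions are admissible -/
  adm_image : ∀ i (A : Set C.L), C.Adm A → C.Adm (map i '' A)
  /-- "log-volumes are invariant under (Indet ↷), (Indet →)" -/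
  logvol_image : ∀ i (A : Set C.L), C.Adm A → C.logvol (map i '' A) = C.logvol A

/-- READING 4 (regions, containment up to isomorphism; TRANSPORT level) for a family `Φ` of
log-volume-preserving isomorphisms: some member of `Φ` carries the `q`-pilot image INTO the holomorphic
hull of the possible images — "contains a region which is isomorphic (not equal) to the region determined
by the q-pilot objects". HYPOTHESIS. [cite: Yamashita2024IUTSurvey, Cor. 13.13 proof p. 360 ll. 35–40]
[claim: Mochizuki2012, status: disputed] -/
@[cite "Yamashita2024IUTSurvey" "Cor. 13.13 proof p. 360 ll. 35–40"]
def QIsoSubHull (Φ : IsoFamily C) : Prop := ∃ i : Φ.I, Φ.map i '' C.Q ⊆ C.Uhol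

/-- The one-member family `{id}` (every container has it). [folklore] -/
def IsoFamily.refl : IsoFamily C where
  I := Unit
  map _ := Equiv.refl C.L
  adm_image _ A hA := by rwa [Equiv.coe_refl, Set.image_id]
  logvol_image _ A _ := by rw [Equiv.coe_refl, Set.image_id]

/-! ## 2. Reading 4 suffices, and is implied by each of Readings 1, 2, 3 -/

/-- **Reading 4 (volume level) ⟹ Cor. 3.12** — `ln ν̄(Q) = ln ν̄(R) ≤ ln ν̄(U^{hol})` by monotonicity of
`ln ν̄` ("comparing the log-volumes", p. 360 l. 30). [folklore] -/
theorem cor312_of_qCongruentSubHull (h : C.QCongruentSubHull) : C.Cor312 := by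
  obtain ⟨R, hR, hsub, hvol⟩ := h
  rw [Cor312, ← hvol]
  exact C.logvol_mono hR C.adm_Uhol hsub

/-- Transport level ⟹ volume level: the carried region `φ(Q)` is admissible, lies in `U^{hol}`, and has
log-volume `ln ν̄(Q)` by invariance. [folklore] -/
theorem qCongruentSubHull_of_qIsoSubHull (Φ : IsoFamily C) (h : C.QIsoSubHull Φ) :
    C.QCongruentSubHull := by
  obtain ⟨i, hi⟩ := h
  exact ⟨Φ.map i '' C.Q, Φ.adm_image i C.Q C.Q_adm, hi, Φ.logvol_image i C.Q C.Q_adm⟩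

/-- **Reading 4 (transport level) ⟹ Cor. 3.12.** [folklore] -/
theorem cor312_of_qIsoSubHull (Φ : IsoFamily C) (h : C.QIsoSubHull Φ) : C.Cor312 :=
  C.cor312_of_qCongruentSubHull (C.qCongruentSubHull_of_qIsoSubHull Φ h)

/-- Reading 2 ⟹ Reading 4 (volume level): take `R := Q`. [folklore] -/
theorem qCongruentSubHull_of_qSubHull (h : C.QSubHull) : C.QCongruentSubHull :=
  ⟨C.Q, C.Q_adm, h, rfl⟩

/-- Reading 1 ⟹ Reading 4 (volume level): take `R :=` the possible image representing `ln ν̄(Q)`.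
[folklore] -/
theorem qCongruentSubHull_of_representedVol (h : C.RepresentedVol) : C.QCongruentSubHull := by
  obtain ⟨i, hi⟩ := h
  exact ⟨C.U i, C.U_adm i, C.U_subset_Uhol i, hi⟩

/-- Reading 3 ⟹ Reading 4 (volume level). [folklore] -/
theorem qCongruentSubHull_of_qIsImage (h : C.QIsImage) : C.QCongruentSubHull :=
  C.qCongruentSubHull_of_qSubHull (C.qSubHull_of_qIsImage h)

/-- For the one-member family `{id}`, Reading 4 at transport level IS Reading 2 — Yamashita's "(not equal)"
is precisely the clause that makes his reading weaker than `QSubHull`/`QIsImage`. [folklore] -/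
theorem qIsoSubHull_refl_iff : C.QIsoSubHull (IsoFamily.refl C) ↔ C.QSubHull := by
  constructor
  · rintro ⟨_, h⟩
    have h' : (Equiv.refl C.L) '' C.Q ⊆ C.Uhol := h
    rw [Equiv.coe_refl, Set.image_id] at h'
    exact h'
  · intro h
    refine ⟨(), ?_⟩
    show (Equiv.refl C.L) '' C.Q ⊆ C.Uhol
    rw [Equiv.coe_refl, Set.image_id]
    exact h

/-- Reading 2 ⟹ Reading 4 at transport level, for any family containing the identity. [folklore] -/
theorem qIsoSubHull_of_qSubHull (Φ : IsoFamily C) (i : Φ.I) (hi : Φ.map i = Equiv.refl C.L)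
    (h : C.QSubHull) : C.QIsoSubHull Φ :=
  ⟨i, by rw [hi, Equiv.coe_refl, Set.image_id]; exact h⟩

end Cor312Setting

namespace Cor312Proof

variable (C : Cor312Setting) (hq : C.negAbsLogq < 0)

/-! ## 3. The author's edge read as Reading 4: sufficient -/

/-- Reading the (xi-f) sentence as Yamashita renders it, at volume level (`QCongruentSubHull`), gives the
real edges. [cite: Yamashita2024IUTSurvey, Cor. 13.13 proof p. 360 ll. 30–40]
[claim: Mochizuki2012, status: disputed] -/
theorem realEdges_of_qCongruentSubHull_reading {O : Obs → Prop}
    (h : O .constitutesConstruction → C.QCongruentSubHull) : RealEdges O (Volumes.ofSetting C hq) :=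
  (realEdges_ofSetting_iff C hq O).2 fun hc => C.cor312_of_qCongruentSubHull (h hc)

/-- … and at transport level (`QIsoSubHull Φ`), for any log-volume-preserving family `Φ`.
[cite: Yamashita2024IUTSurvey, Cor. 13.13 proof p. 360 ll. 30–40] [claim: Mochizuki2012, status: disputed] -/
theorem realEdges_of_qIsoSubHull_reading (Φ : C.IsoFamily) {O : Obs → Prop}
    (h : O .constitutesConstruction → C.QIsoSubHull Φ) : RealEdges O (Volumes.ofSetting C hq) :=
  realEdges_of_qCongruentSubHull_reading C hq fun hc => C.qCongruentSubHull_of_qIsoSubHull Φ (h hc)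

/-- **Loci ∧ chain ∧ the author's edge read as Reading 4 ⟹ Cor. 3.12 for the setting.**
[claim: Mochizuki2012, status: disputed] -/
theorem setting_cor312_of_chain_yamashita {L : Locus → Prop} {O : Obs → Prop} (hL : ∀ c, L c)
    (hC : Chain L O) (Φ : C.IsoFamily) (h : O .constitutesConstruction → C.QIsoSubHull Φ) : C.Cor312 :=
  C.cor312_of_qIsoSubHull Φ (h (constitutesConstruction_of_chain hL hC))

/-! ## 4. Conversely nothing, both ways: two finite witnesses -/

/-- Witness container A: carrier `ℕ`, every region admissible, `ln ν̄(A) := 𝟙_A(0) + 𝟙_A(1) + 𝟙_A(5) − 3`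
(monotone; invariant under the transposition `1 ↔ 5`), hull = identity. [folklore] -/
def yamWitnessContainer : VolumeContainer where
  L := ℕ
  Adm _ := True
  logvol A := A.indicator (fun _ => (1 : ℝ)) 0 + A.indicator (fun _ => (1 : ℝ)) 1 +
    A.indicator (fun _ => (1 : ℝ)) 5 - 3
  logvol_mono _ _ _ _ hAB :=
    sub_le_sub_right (add_le_add (add_le_add
      (Set.indicator_le_indicator_of_subset hAB (fun _ => zero_le_one) 0)
      (Set.indicator_le_indicator_of_subset hAB (fun _ => zero_le_one) 1))
      (Set.indicator_le_indicator_of_subset hAB (fun _ => zero_le_one) 5)) 3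
  hull := ClosureOperator.id (Set ℕ)

/-- Witness setting A: one possible image `{0,1}` (`ln ν̄ = −1`), `q`-pilot image `{5}` (`ln ν̄ = −2 < 0`).
[folklore] -/
def yamWitnessSetting : Cor312Setting where
  toVolumeContainer := yamWitnessContainer
  Idx := Unit
  U _ := ({0, 1} : Set ℕ)
  U_adm _ := trivial
  Uhol_adm := trivial
  Q := ({5} : Set ℕ)
  Q_adm := trivial

/-- `ln ν̄({0,1}) = −1` in witness A. [folklore] -/
private theorem yamWitness_U : yamWitnessContainer.logvol ({0, 1} : Set ℕ) = -1 := by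
  simp only [yamWitnessContainer, Set.indicator_apply, Set.mem_insert_iff, Set.mem_singleton_iff]
  norm_num

/-- `ln ν̄({5}) = −2` in witness A. [folklore] -/
private theorem yamWitness_Q : yamWitnessContainer.logvol ({5} : Set ℕ) = -2 := by
  simp only [yamWitnessContainer, Set.indicator_apply, Set.mem_singleton_iff]
  norm_num

/-- `ln ν̄({0}) = −2` in witness A. [folklore] -/
private theorem yamWitness_zero : yamWitnessContainer.logvol ({0} : Set ℕ) = -2 := by
  simp only [yamWitnessContainer, Set.indicator_apply, Set.mem_singleton_iff]
  norm_num

/-- The hull of the one possible image is `{0,1}` (hull = identity). [folklore] -/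
private theorem yamWitness_Uhol : yamWitnessSetting.Uhol = ({0, 1} : Set ℕ) := by
  show ClosureOperator.id (Set ℕ) (⋃ _ : Unit, ({0, 1} : Set ℕ)) = {0, 1}
  rw [Set.iUnion_const]
  rfl

/-- `−|log(q)| = −2 < 0` in witness A. [folklore] -/
theorem yamWitness_hq : yamWitnessSetting.negAbsLogq < 0 := by
  show yamWitnessContainer.logvol ({5} : Set ℕ) < 0
  rw [yamWitness_Q]; norm_num

/-- Transport of the indicators along the transposition `1 ↔ 5` (an involution): `𝟙_{σ(A)}(a) = 𝟙_A(σ a)`.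
[folklore] -/
private theorem yamWitness_indicator_swap (A : Set ℕ) (a : ℕ) :
    (⇑(Equiv.swap (1 : ℕ) 5) '' A).indicator (fun _ => (1 : ℝ)) a =
      A.indicator (fun _ => (1 : ℝ)) (Equiv.swap (1 : ℕ) 5 a) := by
  rw [Equiv.image_eq_preimage_symm, Equiv.symm_swap]
  exact Set.indicator_comp_right (⇑(Equiv.swap (1 : ℕ) 5)) (g := fun _ => (1 : ℝ))

/-- Witness A's `ln ν̄` is invariant under the transposition `1 ↔ 5` (it only counts membership of `0`, `1`,
`5`, the last two symmetrically). [folklore] -/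
private theorem yamWitness_logvol_swap (A : Set ℕ) :
    yamWitnessContainer.logvol (⇑(Equiv.swap (1 : ℕ) 5) '' A) = yamWitnessContainer.logvol A := by
  simp only [yamWitnessContainer]
  rw [yamWitness_indicator_swap, yamWitness_indicator_swap, yamWitness_indicator_swap,
    Equiv.swap_apply_left, Equiv.swap_apply_right,
    Equiv.swap_apply_of_ne_of_ne (by norm_num : (0 : ℕ) ≠ 1) (by norm_num : (0 : ℕ) ≠ 5)]
  ring

/-- The one-member family `{1 ↔ 5}` on witness A: admissibility (trivially) and log-volume preserved.
[folklore] -/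
def yamWitnessFamily : yamWitnessSetting.IsoFamily where
  I := Unit
  map _ := (Equiv.swap (1 : ℕ) 5 : ℕ ≃ ℕ)
  adm_image _ _ _ := trivial
  logvol_image _ A _ := yamWitness_logvol_swap A

/-- **Reading 4 does not give back Readings 1, 2, 3 or (9-1).** In witness A the transposition `1 ↔ 5`
carries `Q = {5}` onto `{1} ⊆ {0,1} = U^{hol}`, so R4 holds at transport level (for the invariant family
`{1 ↔ 5}`) and at volume level (`R = {0}`), and Cor. 3.12 holds (`−2 ≤ −1`); but `Q ⊄ U^{hol}` (¬R2, hence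
¬R3) and `ln ν̄(U) = −1 ≠ −2 = ln ν̄(Q)` (¬R1, hence ¬(9-1) for every pointed line). "Isomorphic (not
equal)" is a genuinely weaker reading than containment. [folklore] -/
theorem yamashita_not_imp_readings : ∃ (C : Cor312Setting) (hq : C.negAbsLogq < 0) (Φ : C.IsoFamily),
    C.QIsoSubHull Φ ∧ C.QCongruentSubHull ∧ C.Cor312 ∧ (∀ O : Obs → Prop, RealEdges O (Volumes.ofSetting C hq)) ∧
      ¬ C.QSubHull ∧ ¬ C.QIsImage ∧ ¬ C.RepresentedVol ∧ ∀ Rval, ¬ (C.toEtaSetting Rval).MainGoal := by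
  have hiso : yamWitnessSetting.QIsoSubHull yamWitnessFamily := by
    refine ⟨(), ?_⟩
    show ⇑(Equiv.swap (1 : ℕ) 5) '' ({5} : Set ℕ) ⊆ yamWitnessSetting.Uhol
    rw [yamWitness_Uhol, Set.image_singleton, Equiv.swap_apply_right]
    simp
  have hcong := yamWitnessSetting.qCongruentSubHull_of_qIsoSubHull _ hiso
  have hcor := yamWitnessSetting.cor312_of_qCongruentSubHull hcong
  have hrep : ¬ yamWitnessSetting.RepresentedVol := by
    rintro ⟨_, h⟩
    change yamWitnessContainer.logvol ({0, 1} : Set ℕ) = yamWitnessContainer.logvol ({5} : Set ℕ) at h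
    rw [yamWitness_U, yamWitness_Q] at h; norm_num at h
  have hsub : ¬ yamWitnessSetting.QSubHull := by
    intro h
    have h5' : (5 : ℕ) ∈ yamWitnessSetting.Uhol := h (show (5 : ℕ) ∈ ({5} : Set ℕ) by simp)
    rw [yamWitness_Uhol] at h5'
    have h5 : (5 : ℕ) ∈ ({0, 1} : Set ℕ) := h5'
    simp at h5
  exact ⟨yamWitnessSetting, yamWitness_hq, yamWitnessFamily, hiso, hcong, hcor,
    fun O => (realEdges_ofSetting_iff _ _ O).2 fun _ => hcor, hsub,
    fun h => hsub (yamWitnessSetting.qSubHull_of_qIsImage h), hrep,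
    fun Rval h => hrep ((yamWitnessSetting.mainGoal_iff_representedVol Rval).1 h)⟩

/-- Witness container B: carrier `ℕ`, every region admissible,
`ln ν̄(A) := 𝟙_A(0) + 𝟙_A(1) + ½·𝟙_A(5) − 3` (monotone), hull = identity. [folklore] -/
def edgeWitnessContainer : VolumeContainer where
  L := ℕ
  Adm _ := True
  logvol A := A.indicator (fun _ => (1 : ℝ)) 0 + A.indicator (fun _ => (1 : ℝ)) 1 +
    A.indicator (fun _ => (1 / 2 : ℝ)) 5 - 3
  logvol_mono _ _ _ _ hAB :=
    sub_le_sub_right (add_le_add (add_le_add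
      (Set.indicator_le_indicator_of_subset hAB (fun _ => zero_le_one) 0)
      (Set.indicator_le_indicator_of_subset hAB (fun _ => zero_le_one) 1))
      (Set.indicator_le_indicator_of_subset hAB (fun _ => by norm_num) 5)) 3
  hull := ClosureOperator.id (Set ℕ)

/-- Witness setting B: one possible image `{0,1}` (`ln ν̄ = −1`), `q`-pilot image `{5}` (`ln ν̄ = −5/2 < 0`).
[folklore] -/
def edgeWitnessSetting : Cor312Setting where
  toVolumeContainer := edgeWitnessContainer
  Idx := Unit
  U _ := ({0, 1} : Set ℕ)
  U_adm _ := trivial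
  Uhol_adm := trivial
  Q := ({5} : Set ℕ)
  Q_adm := trivial

/-- `ln ν̄({0,1}) = −1` in witness B. [folklore] -/
private theorem edgeWitness_U : edgeWitnessContainer.logvol ({0, 1} : Set ℕ) = -1 := by
  simp only [edgeWitnessContainer, Set.indicator_apply, Set.mem_insert_iff, Set.mem_singleton_iff]
  norm_num

/-- `ln ν̄({5}) = −5/2` in witness B. [folklore] -/
private theorem edgeWitness_Q : edgeWitnessContainer.logvol ({5} : Set ℕ) = -5 / 2 := by
  simp only [edgeWitnessContainer, Set.indicator_apply, Set.mem_singleton_iff]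
  norm_num

/-- The hull of the one possible image is `{0,1}` in witness B. [folklore] -/
private theorem edgeWitness_Uhol : edgeWitnessSetting.Uhol = ({0, 1} : Set ℕ) := by
  show ClosureOperator.id (Set ℕ) (⋃ _ : Unit, ({0, 1} : Set ℕ)) = {0, 1}
  rw [Set.iUnion_const]
  rfl

/-- `−|log(q)| = −5/2 < 0` in witness B. [folklore] -/
theorem edgeWitness_hq : edgeWitnessSetting.negAbsLogq < 0 := by
  show edgeWitnessContainer.logvol ({5} : Set ℕ) < 0
  rw [edgeWitness_Q]; norm_num

/-- In witness B no sub-region of `U^{hol} = {0,1}` has log-volume `−5/2`: such a region misses `5`, so its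
log-volume is an INTEGER minus `3`. [folklore] -/
private theorem edgeWitness_no_congruent (R : Set ℕ) (hR : R ⊆ ({0, 1} : Set ℕ)) :
    edgeWitnessContainer.logvol R ≠ -5 / 2 := by
  classical
  have h5 : (5 : ℕ) ∉ R := fun h => by simpa using hR h
  simp only [edgeWitnessContainer, Set.indicator_apply, h5, if_false, add_zero]
  split_ifs <;> norm_num

/-- **The edge does not give back Reading 4.** In witness B the real edges hold for EVERY `O` (Cor. 3.12
holds: `−5/2 ≤ −1`) while `U^{hol}` contains NO admissible region of log-volume `−|log(q)| = −5/2`; so R4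
fails at volume level, and at transport level for every log-volume-preserving family. Yamashita's
rendering, like R1–R3, says strictly more than the inequality. [folklore] -/
theorem edge_not_imp_yamashita : ∃ (C : Cor312Setting) (hq : C.negAbsLogq < 0),
    (∀ O : Obs → Prop, RealEdges O (Volumes.ofSetting C hq)) ∧ C.Cor312 ∧ ¬ C.QCongruentSubHull ∧
      ∀ Φ : C.IsoFamily, ¬ C.QIsoSubHull Φ := by
  have hcor : edgeWitnessSetting.Cor312 := by
    show edgeWitnessContainer.logvol ({5} : Set ℕ) ≤ edgeWitnessContainer.logvol edgeWitnessSetting.Uhol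
    rw [edgeWitness_Uhol, edgeWitness_U, edgeWitness_Q]; norm_num
  have hno : ¬ edgeWitnessSetting.QCongruentSubHull := by
    rintro ⟨R, -, hsub, hvol⟩
    rw [edgeWitness_Uhol] at hsub
    change edgeWitnessContainer.logvol R = edgeWitnessContainer.logvol ({5} : Set ℕ) at hvol
    rw [edgeWitness_Q] at hvol
    exact edgeWitness_no_congruent R hsub hvol
  exact ⟨edgeWitnessSetting, edgeWitness_hq, fun O => (realEdges_ofSetting_iff _ _ O).2 fun _ => hcor, hcor,
    hno, fun Φ h => hno (edgeWitnessSetting.qCongruentSubHull_of_qIsoSubHull Φ h)⟩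

/-! ## 5. The four readings side by side -/

/-- **The four printed readings of Step (xi), ordered by strength, all sufficient**: R3 ⟹ R2 ⟹ R4,
R3 ⟹ R1 ⟹ R4, R4 ⟹ Cor. 3.12 — with R4 (Yamashita's "contains a region isomorphic to the `q`-pilot
region", volume level) the weakest common consequence of LANA's R1 and of the containment readings R2/R3
typed so far. No reading is adopted. [folklore] -/
theorem four_readings (C : Cor312Setting) :
    (C.QIsImage → C.QSubHull) ∧ (C.QSubHull → C.QCongruentSubHull) ∧ (C.QIsImage → C.RepresentedVol) ∧
      (C.RepresentedVol → C.QCongruentSubHull) ∧ (C.QCongruentSubHull → C.Cor312) :=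
  ⟨C.qSubHull_of_qIsImage, C.qCongruentSubHull_of_qSubHull, C.representedVol_of_qIsImage,
    C.qCongruentSubHull_of_representedVol, C.cor312_of_qCongruentSubHull⟩

end Cor312Proof

end Summit.ABC.IUTFork

end
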